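import Summits.BirchSwinnertonDyer.Rank1Residual.GaloisImage.ModPLatticeHerbrandIterate
import HarnessLib

/-!
# Milne's Lemma I 2.12 with torsion, iterated: `[W/p] − [W[p]] = [W'/p] − [W'[p]]` for `p^N W ≤ W' ≤ W`
# (cell `b2b-bsdres`, team n1011, row T-EPC = Tate's local Euler–Poincaré characteristic; seat p04 GEN 7; stage A4)

HONEST FRAMING (cell `b2b-bsdres`, run/shared/lean/b2b/bsd-rank1-residual/, verbatim in every
file): the goal of the cell is to DELETE the COMBINATION-SHAPED residual classes of the
Birch–Swinnerton-Dyer formula for ALL analytic-rank `≤ 1` elliptic curves over `ℚ` — "full BSD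
formula for every rank `≤ 1` curve in class `C`" assembled STRICTLY from published theorems — so
that the rank-`≤ 1` remainder becomes exactly the CONSTRUCTION-SHAPED classes, which are TYPED
(missing-input `Prop`s), NOT attempted. This is not "finishing BSD". Team n1011 (N10 / N11, the
additive block X4 ∧ `p = 3`): research route; no claim beyond the stated classes; nothing is
booked; no mark / label is changed by this file. Theorems only (no definition, no named fact, no
`sorry`); TOOL theorems of the representation theory of finite groups.  (Placement:
Summits/GaloisImage pending the operator move of the T-EPC cone to the Literature homes.)

## What

The general finite-index case of Milne, *ADT* I Lemma 2.12 (p. 34) in the counting currency of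
stage A1: for `G`-stable subgroups `W' ≤ W` of a `ℤ[G]`-module `V` with `p^N W ≤ W'`, `W/pW` and
`W[p]` finite, `p ∤ #G`, `Z` finite killed by `p`:

* `ModPRepCount.natCard_modP_mul_torsion_eq_of_le_pow` —
  `#Hom_G(Z, W/p) · #Hom_G(Z, W'[p]) = #Hom_G(Z, W'/p) · #Hom_G(Z, W[p])` (and `W'/pW'` is finite),
  by induction along `W' + p^j W` from the elementary step of stage A2/A3
  (`natCard_modP_mul_natCard_torsion_eq_of_le`); the torsion-free special case is stage A3's
  `natCard_modP_eq_of_torsionFree_of_le`.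

Reference: J. S. Milne, *Arithmetic Duality Theorems*, 2nd ed. (2006), I §2, Lemma 2.12.
[MilneADT2006]
-/

noncomputable section

open Function

namespace Summit.BirchSwinnertonDyer.Rank1Residual.GaloisImage

namespace ModPRepCount

open Representation

variable {G : Type*} [Group G]
variable {V : Type*} [AddCommGroup V] (ρ : Representation ℤ G V) (p : ℕ)

/-- The `p`-torsion of a smaller subgroup embeds in that of a bigger one. [folklore] -/
theorem finite_ker_lsmul_of_le (W W' : Submodule ℤ V) (hle : W' ≤ W)
    [Finite (LinearMap.ker (LinearMap.lsmul ℤ W p))] :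
    Finite (LinearMap.ker (LinearMap.lsmul ℤ W' p)) := by
  refine Finite.of_injective (fun t : LinearMap.ker (LinearMap.lsmul ℤ W' p) =>
    (⟨Submodule.inclusion hle (t : W'), ?_⟩ : LinearMap.ker (LinearMap.lsmul ℤ W p))) ?_
  · have ht := t.2
    rw [LinearMap.mem_ker, LinearMap.lsmul_apply] at ht ⊢
    rw [← map_smul, ht, map_zero]
  · intro a b h
    have h' := congrArg (fun x : LinearMap.ker (LinearMap.lsmul ℤ W p) => ((x : W) : V)) h
    exact Subtype.ext (Subtype.ext h')

section Iterate

variable {p} [hp : Fact p.Prime] [Finite G]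
variable {Z : Type*} [AddCommGroup Z] [Finite Z] (σ : Representation ℤ G Z)

/-- **Milne I Lemma 2.12 (finite index, with torsion), counted**: for `G`-stable subgroups
`W' ≤ W` of `V` with `p^N W ≤ W'`, `W/pW` and `W[p]` finite (`p ∤ #G`, `pZ = 0`):
`W'/pW'` is finite and `#Hom_G(Z, W/p)·#Hom_G(Z, W'[p]) = #Hom_G(Z, W'/p)·#Hom_G(Z, W[p])`.
[cite: MilneADT2006, I §2 Lemma 2.12 (p. 34)] -/
theorem natCard_modP_mul_torsion_eq_of_le_pow (hG : ¬ p ∣ Nat.card G) (hZ : ∀ z : Z, p • z = 0)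
    (W : Submodule ℤ V) (hW : ∀ g, W ≤ W.comap (ρ g))
    [Finite (LinearMap.ker (LinearMap.lsmul ℤ W p))]
    [Finite (W ⧸ LinearMap.range (LinearMap.lsmul ℤ W p))] :
    ∀ (N : ℕ) (W' : Submodule ℤ V) (hW' : ∀ g, W' ≤ W'.comap (ρ g)), W' ≤ W →
      (∀ w ∈ W, (p : ℤ) ^ N • w ∈ W') →
      Finite (W' ⧸ LinearMap.range (LinearMap.lsmul ℤ W' p)) ∧
      Nat.card (IntertwiningMap σ ((ρ.subrepresentation W hW).quotient _
          (range_lsmul_le_comap (ρ.subrepresentation W hW) p))) *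
        Nat.card (IntertwiningMap σ ((ρ.subrepresentation W' hW').subrepresentation _
          (ker_lsmul_le_comap (ρ.subrepresentation W' hW') p))) =
      Nat.card (IntertwiningMap σ ((ρ.subrepresentation W' hW').quotient _
          (range_lsmul_le_comap (ρ.subrepresentation W' hW') p))) *
        Nat.card (IntertwiningMap σ ((ρ.subrepresentation W hW).subrepresentation _
          (ker_lsmul_le_comap (ρ.subrepresentation W hW) p))) := by
  intro N
  induction N with
  | zero =>
    intro W' hW' hle hpN
    obtain rfl : W' = W := le_antisymm hle fun w hw => by simpa using hpN w hw
    exact ⟨inferInstance, rfl⟩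
  | succ N ih =>
    intro W' hW' hle hpN
    let W₁ : Submodule ℤ V := W' ⊔ W.map (LinearMap.lsmul ℤ V ((p : ℤ) ^ N))
    have hW₁ : ∀ g, W₁ ≤ W₁.comap (ρ g) := fun g => sup_le
      (fun w hw => Submodule.mem_sup_left (hW' g hw))
      (fun w hw => Submodule.mem_sup_right (map_lsmul_le_comap ρ W hW _ g hw))
    have hle₁ : W₁ ≤ W := sup_le hle (by
      rintro _ ⟨_, hw, rfl⟩
      exact W.smul_mem _ hw)
    have hpN₁ : ∀ w ∈ W, (p : ℤ) ^ N • w ∈ W₁ := fun w hw =>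
      Submodule.mem_sup_right ⟨w, hw, rfl⟩
    have hle' : W' ≤ W₁ := le_sup_left
    have hpW₁ : ∀ w ∈ W₁, (p : ℤ) • w ∈ W' := fun w hw => by
      obtain ⟨a, ha, b, hb, rfl⟩ := Submodule.mem_sup.1 hw
      obtain ⟨c, hc, rfl⟩ := hb
      rw [smul_add]
      refine W'.add_mem (W'.smul_mem _ ha) ?_
      rw [LinearMap.lsmul_apply, smul_smul, ← pow_succ']
      exact hpN c hc
    obtain ⟨fin₁, eq₁⟩ := ih W₁ hW₁ hle₁ hpN₁
    haveI := fin₁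
    haveI : Finite (LinearMap.ker (LinearMap.lsmul ℤ W₁ p)) := finite_ker_lsmul_of_le p W W₁ hle₁
    haveI : Finite (LinearMap.ker (LinearMap.lsmul ℤ W' p)) := finite_ker_lsmul_of_le p W W' hle
    haveI fin' : Finite (W' ⧸ LinearMap.range (LinearMap.lsmul ℤ W' p)) :=
      finite_quotient_range_lsmul_of_le_of_le ρ p W₁ W' hW₁ hW' hle' hpW₁
    refine ⟨fin', ?_⟩
    have step := natCard_modP_mul_natCard_torsion_eq_of_le ρ σ hG hZ W₁ W' hW₁ hW' hle' hpW₁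
    -- cancel the (positive) `W₁` terms
    haveI : Finite (IntertwiningMap σ ((ρ.subrepresentation W₁ hW₁).quotient _
        (range_lsmul_le_comap (ρ.subrepresentation W₁ hW₁) p))) := finite_intertwiningMap σ _
    haveI : Finite (IntertwiningMap σ ((ρ.subrepresentation W₁ hW₁).subrepresentation _
        (ker_lsmul_le_comap (ρ.subrepresentation W₁ hW₁) p))) := finite_intertwiningMap σ _
    have h1 : 0 < Nat.card (IntertwiningMap σ ((ρ.subrepresentation W₁ hW₁).quotient _
      (range_lsmul_le_comap (ρ.subrepresentation W₁ hW₁) p))) := Nat.card_pos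
    have h2 : 0 < Nat.card (IntertwiningMap σ ((ρ.subrepresentation W₁ hW₁).subrepresentation _
      (ker_lsmul_le_comap (ρ.subrepresentation W₁ hW₁) p))) := Nat.card_pos
    -- eq₁ : a * t₁ = q₁ * tW ;  step : q₁ * t' = a' * t₁  ⊢ a * t' = a' * tW
    have key := congrArg₂ (· * ·) eq₁ step
    -- key : (a * t₁) * (q₁ * t') = (q₁ * tW) * (a' * t₁)
    have : Nat.card (IntertwiningMap σ ((ρ.subrepresentation W hW).quotient _
          (range_lsmul_le_comap (ρ.subrepresentation W hW) p))) *
        Nat.card (IntertwiningMap σ ((ρ.subrepresentation W' hW').subrepresentation _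
          (ker_lsmul_le_comap (ρ.subrepresentation W' hW') p))) *
        (Nat.card (IntertwiningMap σ ((ρ.subrepresentation W₁ hW₁).quotient _
          (range_lsmul_le_comap (ρ.subrepresentation W₁ hW₁) p))) *
         Nat.card (IntertwiningMap σ ((ρ.subrepresentation W₁ hW₁).subrepresentation _
          (ker_lsmul_le_comap (ρ.subrepresentation W₁ hW₁) p)))) =
      Nat.card (IntertwiningMap σ ((ρ.subrepresentation W' hW').quotient _
          (range_lsmul_le_comap (ρ.subrepresentation W' hW') p))) *
        Nat.card (IntertwiningMap σ ((ρ.subrepresentation W hW).subrepresentation _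
          (ker_lsmul_le_comap (ρ.subrepresentation W hW) p))) *
        (Nat.card (IntertwiningMap σ ((ρ.subrepresentation W₁ hW₁).quotient _
          (range_lsmul_le_comap (ρ.subrepresentation W₁ hW₁) p))) *
         Nat.card (IntertwiningMap σ ((ρ.subrepresentation W₁ hW₁).subrepresentation _
          (ker_lsmul_le_comap (ρ.subrepresentation W₁ hW₁) p)))) := by
      linear_combination (exp := 1) key
    exact Nat.eq_of_mul_eq_mul_right (Nat.mul_pos h1 h2) this

end Iterate

end ModPRepCount

end Summit.BirchSwinnertonDyer.Rank1Residual.GaloisImage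

end
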